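import Mathlib
import HarnessLib
import HarnessLib.Audit
import Summits.AtomisticToContinuum.Statement
import Literature.Analysis.FluidPDE.EmpiricalCollisionMeasure
import Summits.AtomisticToContinuum.HydrodynamicLimit.Theorems.ImplosionDichotomyHsEosLowDensity
import HarnessLib.Audit.Status.Attr

/-!
Route: LimitCollisionMeasure

DORMANT since 2026-08-23T08:18:42Z (reconciler: no traction for 6 d (last activity statement-grounded at 2026-08-17T07:36:40Z); parked, not closed — `ledger route dormant route-AtomisticToContinuum-LimitCollisionMeasure --off` to reacti) — unstaffed, not closed; items shared with open routes are served there. `ledger route dormant <id> --off` reactivates.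

# Route LimitCollisionMeasure — Euler at fixed density is molecular chaos of the limit collision
measure — free balance, Boltzmann rigidity, thermodynamic contact value, BF18

It suffices to show X = ContactChaos ∧ CollisionRate ∧ LocalSecondLaw ∧ LimitPairStability ∧
CollisionTightness (card limit-collision-measure-chaos,
spine and sole card; conforming D-0027 successor of the retired gen-1 route CollisionMeasureChaos,
re-cut). Pass to the limit PAIR (μ̄, κ̄) of the
empirical one-particle measure μ^N and the normalised empirical COLLISION measure κ^N =
(ε_N/(N+1))·(library
`HardSphereFlow.empiricalCollisionMeasure`, marks (t, x, ω, v⁻, v*⁻)) of ONE deterministic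
hard-sphere trajectory, ε_N = σ(N+1)^(−1/3).
Bogolyubov's exact identity is support and moment tightness of κ^N (CollisionTightness) the fifth,
cheapest crux; dividing the identity by the collision frequency ν_N ≍ N^(1/3) makes COLLISIONAL
BALANCE of κ̄ free, so Boltzmann's rigidity (measure version, support BalanceRigidity) turns
ContactChaos — ONE windowed, oscillation-proof
identity saying κ̄_(t,x) = λ(t,x)·((v−v*)·ω)₋dω·μ̄_(t,x)(dv)μ̄_(t,x)(dv*) (impact isotropy + partner
factorisation + colliders typical) —
into "μ̄_(t,x) is the local Maxwellian of the conserved fields"; CollisionRate pins the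
velocity-free de-fluxed intensity λ = σ³Y(σ³ρ̄)ρ̄²
to the thermodynamic contact value Y = (3/2π)f_ex′ (cut at a band η₁), hence p = hsPressure exactly;
LocalSecondLaw is the clamped
local second law BF18 consumes; LimitPairStability is the typed reduction (compactness + free
balance + rigidity + flux bookkeeping +
Březina–Feireisl weak–strong uniqueness for the cut EOS) to the packing-guarded conjunct — which,
since the statement re-type of
2026-08-16 (D-0032, p126922), IS the sub-problem Statement `_root_.HydrodynamicLimit`: the
Statement's own packing guard ρσ³ < η₀ replaces the
self-consistency input, so the shared DiluteSelfConsistency is no longer consumed.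
Lean: `ContactChaos ∧ CollisionRate ∧ LocalSecondLaw ∧ LimitPairStability ∧ CollisionTightness`

## Assembly
Pure quantifier bookkeeping, PROVED sorry-free as `theorem closes` (glue.lean; re-elaborated
CRUX-ONLY 2026-08-16 against the re-typed,
packing-guarded `_root_.HydrodynamicLimit` — Sketch2.lean rc 0, gate audit `h21_check_closes` ok,
axioms propext/choice/Quot.sound only): its
hypotheses are exactly the five cruxes ContactChaos, CollisionRate, LocalSecondLaw,
LimitPairStability, CollisionTightness; the proved shared
support HsEosLowDensity (stmt-AtomisticToContinuum-0768) is discharged INSIDE the proof by the tree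
theorem `Theorems.hsEosLowDensity_proof`
(its type, `ImplosionDichotomy.HsEosLowDensity`, is the verbatim-identical shared decl,
definitionally equal). LimitPairStability fed with the
other four cruxes and that theorem yields the band threshold η_c; take the Statement's packing
threshold η₀ := η_c/2/2 and the band η₁ := η_c/2;
for given profiles σ₀ := the σ₀ of LimitPairStability at η₁; for σ < σ₀, a classical solution
obeying the Statement's guard ρσ³ < η₀ = η₁/2 on
[0,T), flows Φ and the t = 0 LLN, LimitPairStability returns TendstoHydroFieldsAt at every t < T —
`_root_.HydrodynamicLimit` (the sub-problem
decl, now a def: the packing-guarded d = 3 hard-sphere Euler limit,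
`hydroLimitInBandDim_three_iff_root`) unfolded. DiluteSelfConsistency
(shared stmt-AtomisticToContinuum-3091), which discharged the band against the old UNGUARDED abbrev,
is no longer an input and was dropped from
this route (it keeps its other routes); BalanceRigidity and EmpiricalEnskogIdentity are lemmas for
the prover of LimitPairStability, not
hypotheses of `closes`.

Rationale: WHY THIS LINE. The exact identity for the pair (empirical measure, empirical collision measure) of a
hard-sphere trajectory (Bogolyubov1975;
PulvirentiSimonella2015 arXiv:1504.03215 §3 Thm 1; PulvirentiSimonellaTrushechkin2018) has so far
fed only Boltzmann–Grad validity
(Lanford1975, GST2013, PulvirentiSimonella2016, BGSSAnnals2023), where chaos must be PROPAGATED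
along collision trees; at FIXED reduced
density ν_N → ∞ turns the leading order of the same identity into "Q = 0" for the LIMIT collision
kernel, so the compactness + moment
architecture of kinetic hydrodynamic limits (SaintRaymond2009 Ch. 6; Villani2002 Ch. 1 §2; rigidity
for MEASURES: LuMouhot2015) applies
to N-body collision statistics with no kinetic equation ever derived, and all that is not free is
product structure of κ̄, locality of
its de-fluxed intensity, and the local second law; the PDE end is the relative-energy
weak(mv)–strong uniqueness of the COMPLETE Euler
system (BrezinaFeireisl2018 Def. 2.9/Thm 3.3, BrezinaFeireisl2018Revisited, FeireislNovotny2012),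
which needs no energy-flux closure and
no L^∞ state bounds. Imported areas: measure solutions of kinetic equations, random-measure
compactness, dissipative mv solutions of
hyperbolic systems. Versus the board: BoxDissipativeWeakStrong bets on box momentum-flux closure
directly (state-space Young measure,
kinetic windows); here the Young measure sits on velocity/COLLISION space, where balance is free and
Boltzmann's rigidity does the
identification, and the contact value enters through a velocity-free collision count;
EnskogAdjointDuality tests the identity against
backward linearised-Enskog solutions (duality), a different mechanism; gen-1 CollisionMeasureChaos
compared κ^N with EQUAL-TIME products
μ_s⊗μ_s, whose limits are mixtures of products under kinetic-time oscillations (balance of a mixture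
forces nothing) — here every
μ-functional is windowed in time before products are taken, or depends on conserved mollified fields
only.

RANKED CRUXES. #2 ContactChaos (crux) — AVERAGED MOLECULAR CHAOS AT CONTACT FOR THE LIMIT (card crux
1). For σ < σ₀(profiles), local Gibbs data, every horizon τ, continuous χ(t,x) and continuous mark
test G(ω,v,v*) with |G| ≤ C(1+|v|²): ∫∫χ(t₀,x₀)[K_r(G)·ρ_w² − K_r(q)·⟨ν_r⊗ν_r, Θ_G⟩](t₀,x₀)dt₀dx₀ →
0 in probability (N → ∞ then r → 0), where K_r(F)(t₀,x₀) = (ε/(N+1))∫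
b_r(s−t₀)b_r(y,x₀)F(ω,v,v*)dκ^N is the tent-windowed normalised collision functional
(pre-collisional marks), q = 1/(π|v−v*|) de-fluxes, ρ_w and ν_r are the same space-time window of
the empirical density resp. one-particle measure (products taken AFTER windowing: two-time product
μ_s⊗μ_s′), Θ_G(v,w) = ∫G(ω,v,w)((v−w)·ω)₋dω. Limit content: κ̄_(t,x)(dω dv dv*)·ρ̄² =
F_(t,x)(1)·((v−v*)·ω)₋dω μ̄_(t,x)(dv)μ̄_(t,x)(dv*) a.e. — impact isotropy, partner factorisation and
"colliders are typical" in one identity; quadratic G also excludes a kinetic-energy concentration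
defect. [difficulty: open-problem] (why it might fail: pre-collisional pair correlations at positive
density (ring/caging events; shear-induced contact anisotropy, Lutsko1996) may survive space-time
averaging at Euler order; MD sees non-Enskog collision statistics at moderate packing
(doi:10.1103/physreve.77.041117). Bet: O(Kn) = O(N^(−1/3)) for σ < σ₀.) [Bogolyubov1975,
PulvirentiSimonella2015, PulvirentiSimonellaTrushechkin2018, VanbeijerenErnst1973, Resibois1978,
Lutsko1996, Rezakhanlou2003, doi:10.1103/physreve.77.041117]
#3 CollisionRate (crux) — CONTACT VALUE = THERMODYNAMIC (card crux 2, Enskog form B; absorbs gen-1's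
DensityCap). ∃η₀ ∀η₁ ≤ η₀: for σ < σ₀(η₁, profiles), local Gibbs data, every τ and continuous χ:
(ε/(N+1))∫χ(s,x)/(π|v−v*|)dκ^N − σ³∫₀^τ∫χ·Y₁(σ³ρ_r)·ρ_r² dx ds → 0 in probability (N → ∞ then r →
0), ρ_r the tent-mollified empirical density, Y₁(a) = (3/2π)·f_ex′(min a η₁) the contact value cut
at the band η₁ ((Z−1)/((2π/3)η) on the fluid branch). Limit content: the de-fluxed collision
intensity F_(t,x)(1) equals σ³Y(σ³ρ̄)ρ̄² — no velocity statistics involved; with ContactChaos and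
the derived Maxwellian, p = ρ̄θ̄(1 + (2π/3)σ³ρ̄Y) = hsPressure σ ρ̄ θ̄ exactly. Over-dense pockets
(packing > η₁) or sub-macroscopic clustering (Jensen on η²Y) falsify it, so no separate density cap
is filed. [difficulty: open-problem] (why it might fail: the dynamical contact value out of
equilibrium need not be the thermodynamic Y = (3/2π)f_ex′ (history-dependent rate), and transient
over-dense pockets / sub-macroscopic clustering before T would break it — there is no maximum
principle for the empirical density of deterministic spheres.) [VanbeijerenErnst1973, Resibois1978,
Ruelle1969, LebowitzPenrose1964, Lachowicz1998, Spohn1991, doi:10.1103/physreve.77.041117]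
#4 LocalSecondLaw (crux) — CLAMPED LOCAL SECOND LAW IN PROBABILITY (replaces the card's crux 3:
weak–strong uniqueness for the COMPLETE Euler system consumes local entropy admissibility, not cubic
UI). ∃η₀ ∀η₁ ≤ η₀: for σ < σ₀(η₁, profiles), local Gibbs data, every τ, reals a < b and smooth φ ≥ 0
on ℝ×𝕋³ vanishing for s ≥ τ′ < τ: P(∫₀^τ∫[ρ_r Z_(a,b)(s_c)∂_sφ + Z_(a,b)(s_c) m_r·∇φ]dx ds +
∫ρ_r(0)Z_(a,b)(s_c(0))φ(0)dx > η) → 0 (N → ∞ then r → 0; s_c is the PHYSICAL entropy, so production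
makes the functional ≤ 0, BF18 (2.11)), with (ρ_r, m_r, e_r) the tent-mollified empirical conserved
fields, θ_r = ⅔(e_r/ρ_r − |m_r|²/2ρ_r²), s_c = 3/2 log θ_r − log ρ_r − F_c(ρ_rσ³), F_c(η) = f_ex(min
η η₁) + f_ex′(η₁)(η−η₁)₊ the C¹ cut consistent with Y₁, Z_(a,b)(s) = max a (min s b): BF18's
renormalised entropy inequality for the limit. Pure particle statement — no Euler solution, no data
tie, t = 0 term from the empirical fields themselves. [difficulty: open-problem] (why it might fail:
no H-theorem for a deterministic interacting gas: a LOCAL clamped inequality needs entropy flux =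
Z(s)m (no Euler-order heat current) and positive-time concentration of the mollified fields (ρs
concave); only the GLOBAL Gibbs variational bound (Liouville) is free.) [BrezinaFeireisl2018,
BrezinaFeireisl2018Revisited, Resibois1978, OllaVaradhanYau1993, Spohn1991]
#5 LimitPairStability (crux) — THE LIMIT-PAIR REDUCTION (theorem-track; stated as the implication
from the route's particle statements to the packing-guarded conjunct): ContactChaos → CollisionRate
→ LocalSecondLaw → CollisionTightness (inlined verbatim) → HsEosLowDensity (inlined verbatim) → ∃η_c
> 0 ∀η₁ < η_c ∀profiles ∃σ₀ ∀σ < σ₀ ∀ classical hs-Euler solutions on [0,T) with ρσ³ ≤ η₁/2 ∀ flow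
families with the t = 0 LLN: the empirical fields converge in probability to (ρ, ρu, E)(t) at every
t < T. Intended proof: (i) tightness of (μ^N, κ^N) as random measures on [0,τ]×𝕋³×ℝ³ resp. ×S²×ℝ³×ℝ³
(energy conservation + CollisionTightness), Skorokhod subsequences; (ii) EmpiricalEnskogIdentity ÷
ν_N ⇒ balance and exchange symmetry of κ̄ pathwise; undivided, with collision invariants ⇒ the five
conservation laws with kinetic fluxes ⟨μ̄, v⊗v⟩ and collisional-transfer fluxes = explicit ω-moments
of κ̄ (ε_Nν_N = O(σ³)); (iii) ContactChaos + BalanceRigidity ⇒ μ̄_(t,x) = ρ̄M_(ū,θ̄) with the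
conserved-field parameters and no defect; CollisionRate (+ HsEos, η_c ≤ η₀) ⇒ λ = σ³Y₁ρ̄², p =
ρ̄θ̄Z_c(ρ̄σ³), zero heat flux; (iv) LocalSecondLaw + exact energy ⇒ the limit is a.s. a dissipative
(Dirac-Young-measure) solution of the cut complete hs-Euler system in the sense of BF18 Def. 2.9
with the Euler initial data; BF18 Thm 3.3 (Gibbs relation, (ηZ_c)′ > 0, |p_c| ≤ Cρe since ρ_rσ³ ≤
close packing deterministically) ⇒ it equals the classical solution on [0,T) a.s. ⇒ full-sequence
convergence in probability. [deps: ContactChaos, CollisionRate, LocalSecondLaw, CollisionTightness,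
HsEosLowDensity, BalanceRigidity, EmpiricalEnskogIdentity] [difficulty: L] (why it might fail: BF18
Thm 3.3 must be re-run for a RANDOM limit pair with clamped entropies, the cut EOS and Lean junk
(ρ_r = 0, log 0 = 0); the collisional stress must be shown defect-free from 4th-moment tightness;
tightness/Skorokhod for (μ^N, κ^N) in this form is unprinted.) [BrezinaFeireisl2018,
BrezinaFeireisl2018Revisited, FeireislNovotny2012, LuMouhot2015, SaintRaymond2009, Wiedemann2018]
#9 CollisionTightness (crux, ledger rank 9 = lowest-priority crux; support at open, re-kinded
2026-08-16 because it is a hypothesis of `closes` and not a known result) — MOMENT TIGHTNESS OF THE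
NORMALISED COLLISION MEASURE (card S1, strengthened to carry every uniform-integrability need of the
reduction; 4th antecedent of LimitPairStability, verbatim): for σ < σ₀(profiles), local Gibbs data,
every τ, δ there are K, N₀ with P((ε/(N+1))∫(1 + |v|⁴ + |v*|⁴)(1 + 1/(π|v−v*|))dκ^N > K) ≤ δ for N ≥
N₀. Expected proof: E under the invariant canonical law by stationarity (Enskog/Santaló value,
finite; Chernov1997 mean-free-path identity), an equilibrium large-deviation bound for the
super-extensive (N^(4/3)) count, and Cauchy–Schwarz / entropy transfer H(local Gibbs | canonical) =
O(N) to the local Gibbs law (engine of card spacetime-superextensive-ld). [difficulty: M] (why it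
might fail: no a-priori collision bound out of equilibrium: transient near-close-packed clusters
(contact value Y(η) → ∞) or energy concentration before τ could push the |v|⁴- and 1/|v−v*|-weighted
super-extensive count past O(N^(4/3)) with positive probability; only the invariant-law mean is
explicit.) [Chernov1997, BuragoFerlegerKononenko1998, PulvirentiSimonella2015, GST2013, Spohn1991]
#9 BalanceRigidity (support) — BOLTZMANN'S UNIQUENESS OF COLLISION EQUILIBRIA, MEASURE VERSION (card
S3): a finite Borel measure m on ℝ³ with finite second moment whose product kernel is collisionally
balanced, ∫∫∫((v−w)·ω)₊[φ(v′)+φ(w′)−φ(v)−φ(w)]dω m(dv)m(dw) = 0 for all bounded continuous φ, is a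
(possibly zero) point mass or ρ·Maxwellian(θ,u)·Lebesgue with ρ, θ > 0. [difficulty: M]
[LuMouhot2015, CercignaniIllnerPulvirenti1994, Villani2002]
#9 EmpiricalEnskogIdentity (support) — THE EXACT IDENTITY along one trajectory (card S2;
Bogolyubov's microscopic Enskog equation, torus version, now over the library's
`empiricalCollisionMeasure`): for every hard-sphere flow Φ on 𝕋³ (0 < ε < 1/2, any N), every good z,
τ > 0, a ∈ C¹(ℝ), smooth b on 𝕋³, continuous c on ℝ³: a(τ)⟨μ_τ, b c⟩ − a(0)⟨μ_0, b c⟩ − ∫₀^τ[a′⟨μ_s,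
b c⟩ + a⟨μ_s, (v·∇b)c⟩]ds = N⁻¹∫a(t)b(x)[c(v⁺) − c(v⁻)]dκ(t,x,ω,v⁻,v*⁻) over collisions in (0,τ], v⁺
= (reflectVel ω (v⁻,v*⁻)).1. [difficulty: provable-now] [Bogolyubov1975, PulvirentiSimonella2015,
GST2013]
#9 HsEosLowDensity (support) — (shared stmt-AtomisticToContinuum-0768, verbatim; PROVED in the tree
2026-08-16, `Theorems.hsEosLowDensity_proof`, linked as `HsEosLowDensity_holds`) hard-sphere
equation of state at low density: f_ex = hsExcessFreeEnergy is real-analytic on a neighbourhood of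
[0,η₀) with F(0) = 0, F′(0) = 2π/3 and the canonical thermodynamic limit exists there; makes Y₁,
Z_c, F_c continuous and the cut EOS smooth (antecedent of LimitPairStability). [difficulty: L]
[Ruelle1969, LebowitzPenrose1964]
(Dropped 2026-08-16: DiluteSelfConsistency, shared stmt-AtomisticToContinuum-3091, was a support of
this route only to discharge the packing band against the old unguarded abbrev; since the statement
re-type D-0032/p126922 the guard ρσ³ < η₀ is part of the Statement and LimitPairStability's
conclusion is the Statement up to η₀ := η₁/2, so the item is no longer load-bearing here and keeps
its other routes.)

TWO-LAYER PLAN. Foreseen glued splits (k ≤ 3, depth 1; nothing filed now): ContactChaos ⇐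
EquilibriumContactLLN (under the invariant canonical law G the
windowed statistics of κ^N converge to the Enskog kernel: stationarity + Santaló/Chernov
mean-free-path identity + spatial decorrelation;
Chernov1997) → NonequilibriumTransfer (price the chaos defect super-extensively under G and transfer
along H(f_t|G) = H(f_0|G) = O(N);
engine of card spacetime-superextensive-ld) → ContactChaos. CollisionRate ⇐ the same pair with the
finite-N canonical contact value
Y_N → Y (HsEosLowDensity). LimitPairStability ⇐ LimitPairCompactness (tightness, Skorokhod, free
balance, conservation laws with
κ̄-fluxes) → KineticRigidityClosure (ContactChaos + CollisionRate + BalanceRigidity ⇒ μ̄ = ρ̄M, p =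
ρ̄θ̄Z_c, no heat flux, no defect)
→ CutEosBF18 (BF18 Gronwall for the cut EOS with clamps, random data, Markov) → LimitPairStability.
LocalSecondLaw ⇐
MeanLocalEntropyInequality (annealed) → PositiveTimeConcentration → LocalSecondLaw, if the quenched
form stalls.

KILL CRITERIA. ¬ContactChaos in substance — a smooth pre-shock local Gibbs profile at arbitrarily
small σ whose limit collision kernel is not
λ·((v−v*)·ω)₋dω·μ̄⊗μ̄ (e.g. an N⁰ shear-induced pre-collisional correlation surviving space-time
averaging) — closes the route
(`close --reason refuted:ContactChaos`) and is summit-level negative evidence against every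
Enskog-type closure; ¬ContactChaos by a
windowing/normalisation artefact (windows at t₀ ∈ {0, τ}, vacuum regions) ⇒ restate. ¬CollisionRate
with ContactChaos intact ⇒ pivot,
same route, to the card's form (A): λ(t,x) = Λ(ρ̄,θ̄) for SOME continuous Λ plus EOS rigidity from
the free global second law (card
invariant-gibbs-entropy-bookkeeping (v)). ¬LocalSecondLaw by a clamp/junk artefact ⇒ restate; by a
genuine positive-time coarse-grained
entropy deficit ⇒ the dissipative class is the wrong currency: pivot to local ENERGY closure + L^∞
caps (Dafermos on 𝕋³ with the free
global entropy) with cubic UI (HighMomentumCutoff instance) as the new crux, or close.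
LimitPairStability is theorem-track: a refutation
exposes mis-typing ⇒ restate. DiluteSelfConsistency is no longer an input (since the 2026-08-16
re-type the Statement IS the
packing-guarded conjunct), so its fate does not touch this route. A route proving FluxClosure +
EntropyAdmissibility (BoxDissipativeWeakStrong) first
makes this front-end an alternative proof of FluxClosure (supersede decision by tenure);
RelEntropyVanishing-type closures moot it.

NOT DECOMPOSED YET. The equilibrium LLN for κ^N and the non-equilibrium transfer (children of
ContactChaos / CollisionRate); the annealed weakening of
LocalSecondLaw; for LimitPairStability the cut-EOS stability lemmas (Gibbs relation, (ηZ_c)′ > 0,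
coercivity of E_(Z_(a,b)) for the cut
EOS), HsEntropyConvex (ex stmt-0817, a `--supports` lemma, not re-filed), measurability of the
windowed functionals on Φ.good (library:
EmpiricalCollisionMeasureMeasurable, CollisionalTransferMeasurable), the passage subsequence → full
sequence, and the deterministic
close-packing bound ρ_rσ³ ≤ c_cp(1 + O(ε/r)); constants η₀ (EOS analyticity radius) and the tent
shapes — all layer-2 or prover-level.

CHEAPEST FALSIFIER. Normalisation audit against equilibrium MD: for the homogeneous gas (constant
profiles, invariant canonical law) ContactChaos and
CollisionRate are LLN statements whose means follow from stationarity — ordered-pair rate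
(N+1)²ε²Y·π⟨|v−w|⟩, de-fluxed intensity ×
ε/(N+1) = σ³Yρ̄², ∫((v−w)·ω)₋dω = π|v−w|, |S²| = 4π for `sphereMeasure` — and Visco–van
Wijland–Trizac (doi:10.1103/physreve.77.041117)
tabulate hard-sphere collision frequencies and colliding-pair velocity statistics against Enskog for
packing 0.05–0.49: a refuter checks
the constants (3/(2π), ε/(N+1), π) and whether measured deviations from molecular chaos scale away
with Kn; a non-factorising residual
that does not shrink like N^(−1/3) in a smooth shear profile (event-driven MD, ~10⁵ spheres, kit)
kills ContactChaos. Lean-level junk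
audit done by hand: empty windows (ρ_r = 0 ⇒ every term 0), one-particle windows (θ_r = 0, log 0 =
0, clamped), self-pairs in μ_s⊗μ_s′
(O(1/(N+1))), windows cut at t₀ ∈ {0,τ} (both sides of ContactChaos scale alike) — no trivial truth
or falsity found. Analytic proxy: the first
shear correction to contact statistics is O(Kn) (Lutsko1996) — consistent, not a kill.

NUMBERS. Scales (macroscopic units, Spohn1991 I.3): N+1 spheres of diameter ε = σ(N+1)^(−1/3);
collisions per particle per unit time
ν_N ≍ 4√(πθ)σ²Y(N+1)^(1/3); normalisation ε/(N+1) makes κ^N([0,τ]) = O(τσ³); ε_Nν_N = O(σ³) keeps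
collisional transfer finite.
EOS: Y(η) = (3/2π)f_ex′(η) = (Z−1)/((2π/3)η) = 1 + (5π/12)η + O(η²), Z = 1 + (2π/3)ηY, f_ex′(0) =
2π/3 (B₂, unit diameter); freezing at
packing fraction ≈ 0.494 (η = ρd³ ≈ 0.943) bounds the fluid branch; the band η₁ < η_c ≤ η₀ sits
inside the virial analyticity radius
(Ruelle1969 Thm 4.3.2). ∫_(S²)((v−w)·ω)₋dω = π|v−w|; ⟨|v−w|⟩ = 4√(θ/π) under M_θ⊗M_θ. Items at open:
10 (4 cruxes, 5 supports,
1 assembly); after the 2026-08-16 retype repair 9 (5 cruxes — CollisionTightness promoted —, 3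
supports — HsEosLowDensity proved —, 1 assembly = the
5-antecedent, crux-only shape of `closes`); every signature < 3500 chars (gate cap 4000).

DEFINITION REQUESTS. None now: the empirical collision measure requested by gen-1 has landed
(`Literature.Analysis.FluidPDE.HardSphereFlow.empiricalCollisionMeasure`,
files HardSphereCollisionRecord / EmpiricalCollisionMeasure), so every item elaborates over
Literature.MathematicalPhysics.KineticTheory
(HardSphereEuler), Literature.Analysis.FluidPDE and Literature.Analysis.FunctionSpaces.Torus
(Sketch.lean / OneLine.lean rc 0). A later
convenience refactor `Kinetic.tentWindow` / `Kinetic.windowedCollisionFunctional` would shorten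
ContactChaos (3455 chars) without changing
its meaning (not requested). Bib wanted: ViscoVanwijlandTrizac2008 (doi:10.1103/physreve.77.041117;
`ledger bib add` pending gate).

Novelty: Searches (2026-08-15): `lit search --hybrid --no-graph "empirical collision measure hard spheres
Enskog molecular chaos contact value
hydrodynamic limit"` (12 vector hits, textbooks only: Soto2016 pp 295/301, ChapmanCowling1970; fts
leg skipped by the daemon);
`lit search --source crossref "empirical measure hard sphere dynamics collision measure Enskog
hydrodynamic limit"` (10; Frezzotti 1998
MD-vs-Enskog shock profiles doi:10.1016/s0898-1221(97)00261-7); `--source crossref "collisional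
statistics of the hard-sphere gas"`
(5: doi:10.1103/physreve.77.041117, doi:10.1021/jp800333h); `--source crossref "Lu Mouhot measure
solutions Boltzmann"` (6:
doi:10.1016/j.jde.2011.10.021, doi:10.1016/j.jde.2015.01.039); `--source crossref "Brezina Feireisl
measure-valued complete Euler"`
(5: doi:10.2969/jmsj/77337733, doi:10.1007/s00033-018-0951-8, doi:10.1007/s10208-019-09433-z,
doi:10.21136/am.2021.0279-20);
`--source zbmath "measure solutions Boltzmann equation equilibrium Maxwellian uniqueness"` (5;
doi:10.1137/23m1562123); `lit galaxy search
--star all` ×3 phrasings (0 rows each); `ledger negatives --problem AtomisticToContinuum` (6); board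
read: the 99 route files by thesis
line, in full the retired predecessor CollisionMeasureChaos, BoxDissipativeWeakStrong,
EnskogAdjointDuality/EmpiricalEnskogDuality,
StiffCollisionalRelaxation, CompensatedSlabClusters, MaxwellianCollisionCLT; the card's own
crossref/zbMATH sweep and its refuter
novelty audit (grade new-combination). Graph re-rank  [refs: 10.1016/s0898-1221(97, 10.1103/physreve.77.041117, 10.1021/jp800333h, 10.1016/j.jde.2011.10.021, 10.1016/j.jde.2015.01.039, 10.2969/jmsj/77337733, 10.1007/s00033-018-0951-8, 10.1007/s10208-019-09433-z, 10.21136/am.2021.0279-20, 10.1137/23m1562123, 1504.03215, doi:10.1016/s0898-1221, doi:10.1103/physreve.77.041117, doi:10.1021/jp800333h, doi:10.1016/j.jde.2011.10.021, doi:10.1016/j.jde.2015.01.039,]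

Barriers (technique_class: limit-collision-measure kinetic-formulation young-measure): - technique_class: limit-collision-measure kinetic-formulation young-measure
- Literature.Barriers.AtomisticToContinuum.DiluteRegimeBarrier: evaded — (N+1)ε³ = σ³ is fixed (no
Boltzmann–Grad), no kinetic equation for f^(1) is derived or used; the Enskog structure enters only
through the exact finite-N identity and a velocity-free contact-value count, and the EOS is the full
p = ρθZ (collisional transfer survives since ε_Nν_N = O(σ³)), so its ideal-gas trap cannot occur.
- Literature.Barriers.AtomisticToContinuum.DiluteRegimeBarrierNarrow: same evasion; nothing here is
a joint N → ∞, density → 0 limit.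
- Literature.Barriers.AtomisticToContinuum.NoDensityExpansionBarrier: not met — nothing is expanded
or resummed in density; its ring-collision physics is exactly ContactChaos's "why it might fail",
bet to be O(Kn) at Euler order after space-time averaging, never summed.
- Literature.Barriers.AtomisticToContinuum.NoDensityExpansionBarrierNarrow: same.
- Literature.Barriers.AtomisticToContinuum.BoltzmannHypothesisBarrier: it does not fully evade it;
the bet is that the local-equilibrium input shrinks to product structure of ONE (ω,v,v*)-kernel per
macroscopic point (ContactChaos) plus a velocity-free collision count (CollisionRate) — no
classification of stationary states of the infinite system, no one-block estimate; on the barrier's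
kernels (ideal gas: κ̄ = 0; hard rods: balance is an identity) the mechanism is vacuous, hence
useless, consistent with the catalogue.
- Literature.

History (route lifecycle, newest last):
- 2026-08-16T23:25:31Z · rev 2: restated Assembly (stmt-AtomisticToContinuum-13357) — route-repair (retype hydro2, p126922; unit rrepair-AtomisticToContinuum-LimitColl-7e2513f5): closes RE-ELABORATED against the packing-guarded def _root_.Hydrody (planner-rrepair-AtomisticToContinuum-LimitColl-7e2513f5-0)
- 2026-08-16T23:25:31Z · rev 2: dropped DiluteSelfConsistency — route-repair (retype hydro2, p126922; unit rrepair-AtomisticToContinuum-LimitColl-7e2513f5): closes RE-ELABORATED against the packing-guarded def _root_.Hydrody (planner-rrepair-AtomisticToContinuum-LimitColl-7e2513f5-0)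
- 2026-08-16T23:29:43Z · rev 4: restated Assembly (stmt-AtomisticToContinuum-17652) — route-repair step 3 (crux-only closes; unit rrepair-AtomisticToContinuum-LimitColl-7e2513f5): after rev 3 re-kinded CollisionTightness support→crux (lint glue.n (planner-rrepair-AtomisticToContinuum-LimitColl-7e2513f5-0)
- 2026-08-23T08:18:42Z · DORMANT — reconciler: no traction for 6 d (last activity statement-grounded at 2026-08-17T07:36:40Z); parked, not closed — `ledger route dormant route-AtomisticToContinuu (operator:999:2223670)

sub-problem: HydrodynamicLimit · status: dormant · opened planner-plancard-AtomisticToContinuum-Hydrody-0bcf4f2a-g2-0 2026-08-15T19:01:20Z · rev 5 · ledger route-AtomisticToContinuum-LimitCollisionMeasure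
GENERATED by the gate from the ledger (D-0016/17). Provers cite these decls: `theorem foo : Summit.AtomisticToContinuum.HydrodynamicLimit.Theses.LimitCollisionMeasure.<Decl> := …` in Summits/AtomisticToContinuum/HydrodynamicLimit/Theorems/<Name>.lean.
-/

namespace Summit.AtomisticToContinuum.HydrodynamicLimit.Theses.LimitCollisionMeasure

open scoped BigOperators Topology Manifold Classical MeasureTheory ProbabilityTheory Matrix InnerProductSpace ComplexConjugate ContinuousMap
open Filter Set Function TopologicalSpace MeasureTheory

attribute [summit_statement] _root_.HydrodynamicLimit

/-- item stmt-AtomisticToContinuum-13350 · crux · rank 2 · open · by planner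
why it might fail: pre-collisional pair correlations at positive density (ring/caging events; shear-induced contact anisotropy, Lutsko1996) may survive space-time averaging at Euler order; MD sees non-Enskog collision statistics at moderate packing (doi:10.1103/physreve.77.041117). Bet: O(Kn) = O(N^(−1/3)) for σ < σ₀.
sources: Bogolyubov1975, PulvirentiSimonella2015, PulvirentiSimonellaTrushechkin2018, VanbeijerenErnst1973, Resibois1978, Lutsko1996
[crux] AVERAGED MOLECULAR CHAOS AT CONTACT FOR THE LIMIT (card crux 1). For σ < σ₀(profiles), local
Gibbs data, every horizon τ, continuous χ(t,x) and continuous mark test G(ω,v,v*) with |G| ≤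
C(1+|v|²): ∫∫χ(t₀,x₀)[K_r(G)·ρ_w² − K_r(q)·⟨ν_r⊗ν_r, Θ_G⟩](t₀,x₀)dt₀dx₀ → 0 in probability (N → ∞
then r → 0), where K_r(F)(t₀,x₀) = (ε/(N+1))∫ b_r(s−t₀)b_r(y,x₀)F(ω,v,v*)dκ^N is the tent-windowed
normalised collision functional (pre-collisional marks), q = 1/(π|v−v*|) de-fluxes, ρ_w and ν_r are
the same space-time window of the empirical density resp. one-particle measure (products taken AFTER
windowing: two-time product μ_s⊗μ_s′), Θ_G(v,w) = ∫G(ω,v,w)((v−w)·ω)₋dω. Limit content: κ̄_(t,x)(dω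
dv dv*)·ρ̄² = F_(t,x)(1)·((v−v*)·ω)₋dω μ̄_(t,x)(dv)μ̄_(t,x)(dv*) a.e. — impact isotropy, partner
factorisation and "colliders are typical" in one identity; quadratic G also excludes a
kinetic-energy concentration defect. [difficulty: open-problem] -/
@[route_item "route-AtomisticToContinuum-LimitCollisionMeasure", crux]
def ContactChaos : Prop :=
  ∀ (a₀ θ₀ : Literature.MathematicalPhysics.KineticTheory.T3 → ℝ) (u₀ : Literature.MathematicalPhysics.KineticTheory.T3 → Literature.MathematicalPhysics.KineticTheory.V3), Continuous a₀ → Continuous θ₀ → Continuous u₀ → (∀ x, 0 < a₀ x) → (∀ x, 0 < θ₀ x) → ∃ σ₀ : ℝ, 0 < σ₀ ∧ ∀ σ : ℝ, 0 < σ → σ < σ₀ → ∀ Φ : (N : ℕ) → Literature.Analysis.FluidPDE.HardSphereFlow (Literature.Analysis.FluidPDE.Torus.geometry (Fin 3)) (Literature.MathematicalPhysics.KineticTheory.hsDiameter σ N) (N + 1), ∀ τ : ℝ, 0 < τ → ∀ χ : ℝ × Literature.MathematicalPhysics.KineticTheory.T3 → ℝ, Continuous χ → ∀ G : Literature.MathematicalPhysics.KineticTheory.V3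 × Literature.MathematicalPhysics.KineticTheory.V3 × Literature.MathematicalPhysics.KineticTheory.V3 → ℝ, Continuous G → (∃ C : ℝ, ∀ p, |G p| ≤ C * (1 + ‖p.2.1‖ ^ 2)) → ∀ η δ : ℝ, 0 < η → 0 < δ → ∃ r₀ : ℝ, 0 < r₀ ∧ ∀ r : ℝ, 0 < r → r < r₀ → ∃ N₀ : ℕ, ∀ N : ℕ, N₀ ≤ N → let ε := Literature.MathematicalPhysics.KineticTheory.hsDiameter σ N; let μ := fun (z : Literature.Analysis.FluidPDE.Config (N + 1) (Fin 3) Literature.MathematicalPhysics.KineticTheory.T3) (s : ℝ) => Literature.Analysis.FluidPDE.empiricalMeasure ((Φ N).flow s z); let κ := fun (z : Literature.Analysis.FluidPDE.Config (N + 1) (Fin 3) Literature.MathematicalPhysics.KineticTheory.T3) => (Φ N).empiricalCollisionMeasure (Set.Icc 0 τ) z; let bx : Literature.MathematicalPhysics.KineticTheory.T3 → Literature.MathematicalPhysics.KineticTheory.T3 → ℝ := fun x y => 3 / (Real.pi * r ^ 3) * max (1 - Literature.Analysis.FluidPDE.Torus.euclidDist x y / r) 0; let bt : ℝ → ℝ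 := fun a => r⁻¹ * max (1 - |a| / r) 0; let Θ : Literature.MathematicalPhysics.KineticTheory.V3 → Literature.MathematicalPhysics.KineticTheory.V3 → ℝ := fun v w => ∫ ω : Metric.sphere (0 : Literature.MathematicalPhysics.KineticTheory.V3) 1, G ((ω : Literature.MathematicalPhysics.KineticTheory.V3), v, w) * Literature.MathematicalPhysics.KineticTheory.hardSphereKernel (w, v) ω ∂Literature.MathematicalPhysics.KineticTheory.sphereMeasure; let K := fun (F : Literature.MathematicalPhysics.KineticTheory.V3 × Literature.MathematicalPhysics.KineticTheory.V3 × Literature.MathematicalPhysics.KineticTheory.V3 → ℝ) (z : Literature.Analysis.FluidPDE.Config (N + 1) (Fin 3) Literature.MathematicalPhysics.KineticTheory.T3) (t₀ : ℝ) (x₀ : Literature.MathematicalPhysics.KineticTheory.T3) => ε / (N + 1 : ℝ) * ∫ m, bt (m.1 - t₀) * bx m.2.1 x₀ * F m.2.2 ∂(κ z); let ρw := fun (z : Literature.Analysis.FluidPDE.Config (N + 1) (Fin 3) Literature.MathematicalPhysics.KineticTheory.T3) (t₀ : ℝ) (x₀ : Literature.MathematicalPhysics.KineticTheory.T3) =>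 ∫ s in Set.Icc (0 : ℝ) τ, bt (s - t₀) * ∫ q, bx q.1 x₀ ∂(μ z s); let Pw := fun (z : Literature.Analysis.FluidPDE.Config (N + 1) (Fin 3) Literature.MathematicalPhysics.KineticTheory.T3) (t₀ : ℝ) (x₀ : Literature.MathematicalPhysics.KineticTheory.T3) => ∫ s in Set.Icc (0 : ℝ) τ, ∫ s' in Set.Icc (0 : ℝ) τ, bt (s - t₀) * bt (s' - t₀) * ∫ p, bx p.1.1 x₀ * bx p.2.1 x₀ * Θ p.1.2 p.2.2 ∂((μ z s).prod (μ z s')); let D := fun (z : Literature.Analysis.FluidPDE.Config (N + 1) (Fin 3) Literature.MathematicalPhysics.KineticTheory.T3) => ∫ t₀ in Set.Icc (0 : ℝ) τ, ∫ x₀ : Literature.MathematicalPhysics.KineticTheory.T3, χ (t₀, x₀) * (K (fun p => G p) z t₀ x₀ * ρw z t₀ x₀ ^ 2 - K (fun p => 1 / (Real.pi * ‖p.2.1 - p.2.2‖)) z t₀ x₀ * Pw z t₀ x₀); Literature.MathematicalPhysics.KineticTheory.localGibbsLaw σ a₀ u₀ θ₀ N (Φ N) {z | η < |D z|} ≤ ENNReal.ofReal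 δ

/-- item stmt-AtomisticToContinuum-13351 · crux · rank 3 · open · by planner
why it might fail: the dynamical contact value out of equilibrium need not be the thermodynamic Y = (3/2π)f_ex′ (history-dependent rate), and transient over-dense pockets / sub-macroscopic clustering before T would break it — there is no maximum principle for the empirical density of deterministic spheres.
sources: VanbeijerenErnst1973, Resibois1978, Ruelle1969, LebowitzPenrose1964, Lachowicz1998, Spohn1991
[crux] CONTACT VALUE = THERMODYNAMIC (card crux 2, Enskog form B; absorbs gen-1's DensityCap). ∃η₀
∀η₁ ≤ η₀: for σ < σ₀(η₁, profiles), local Gibbs data, every τ and continuous χ: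
(ε/(N+1))∫χ(s,x)/(π|v−v*|)dκ^N − σ³∫₀^τ∫χ·Y₁(σ³ρ_r)·ρ_r² dx ds → 0 in probability (N → ∞ then r →
0), ρ_r the tent-mollified empirical density, Y₁(a) = (3/2π)·f_ex′(min a η₁) the contact value cut
at the band η₁ ((Z−1)/((2π/3)η) on the fluid branch). Limit content: the de-fluxed collision
intensity F_(t,x)(1) equals σ³Y(σ³ρ̄)ρ̄² — no velocity statistics involved; with ContactChaos and
the derived Maxwellian, p = ρ̄θ̄(1 + (2π/3)σ³ρ̄Y) = hsPressure σ ρ̄ θ̄ exactly. Over-dense pockets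
(packing > η₁) or sub-macroscopic clustering (Jensen on η²Y) falsify it, so no separate density cap
is filed. [difficulty: open-problem] -/
@[route_item "route-AtomisticToContinuum-LimitCollisionMeasure", crux]
def CollisionRate : Prop :=
  ∃ η₀ : ℝ, 0 < η₀ ∧ ∀ η₁ : ℝ, 0 < η₁ → η₁ ≤ η₀ → ∀ (a₀ θ₀ : Literature.MathematicalPhysics.KineticTheory.T3 → ℝ) (u₀ : Literature.MathematicalPhysics.KineticTheory.T3 → Literature.MathematicalPhysics.KineticTheory.V3), Continuous a₀ → Continuous θ₀ → Continuous u₀ → (∀ x, 0 < a₀ x) → (∀ x, 0 < θ₀ x) → ∃ σ₀ : ℝ, 0 < σ₀ ∧ ∀ σ : ℝ, 0 < σ → σ < σ₀ → ∀ Φ : (N : ℕ) → Literature.Analysis.FluidPDE.HardSphereFlow (Literature.Analysis.FluidPDE.Torus.geometry (Fin 3)) (Literature.MathematicalPhysics.KineticTheory.hsDiameter σ N) (N + 1), ∀ τ : ℝ, 0 < τ → ∀ χ : ℝ × Literature.MathematicalPhysics.KineticTheory.T3 → ℝ, Continuous χ → ∀ η δ : ℝ, 0 < η → 0 < δ → ∃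 r₀ : ℝ, 0 < r₀ ∧ ∀ r : ℝ, 0 < r → r < r₀ → ∃ N₀ : ℕ, ∀ N : ℕ, N₀ ≤ N → let ε := Literature.MathematicalPhysics.KineticTheory.hsDiameter σ N; let μ := fun (z : Literature.Analysis.FluidPDE.Config (N + 1) (Fin 3) Literature.MathematicalPhysics.KineticTheory.T3) (s : ℝ) => Literature.Analysis.FluidPDE.empiricalMeasure ((Φ N).flow s z); let κ := fun (z : Literature.Analysis.FluidPDE.Config (N + 1) (Fin 3) Literature.MathematicalPhysics.KineticTheory.T3) => (Φ N).empiricalCollisionMeasure (Set.Icc 0 τ) z; let bx : Literature.MathematicalPhysics.KineticTheory.T3 → Literature.MathematicalPhysics.KineticTheory.T3 → ℝ := fun x y => 3 / (Real.pi * r ^ 3) * max (1 - Literature.Analysis.FluidPDE.Torus.euclidDist x y / r) 0; let ρm := fun (z : Literature.Analysis.FluidPDE.Config (N + 1) (Fin 3) Literature.MathematicalPhysics.KineticTheory.T3) (s : ℝ) (x₀ : Literature.MathematicalPhysics.KineticTheory.T3) => ∫ q, bx q.1 x₀ ∂(μ z s); let Y : ℝ → ℝ := fun a => 3 / (2 *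 Real.pi) * deriv Literature.MathematicalPhysics.KineticTheory.hsExcessFreeEnergy (min a η₁); let D := fun (z : Literature.Analysis.FluidPDE.Config (N + 1) (Fin 3) Literature.MathematicalPhysics.KineticTheory.T3) => ε / (N + 1 : ℝ) * ∫ m, χ (m.1, m.2.1) / (Real.pi * ‖m.2.2.2.1 - m.2.2.2.2‖) ∂(κ z) - σ ^ 3 * ∫ s in Set.Icc (0 : ℝ) τ, ∫ x : Literature.MathematicalPhysics.KineticTheory.T3, χ (s, x) * Y (σ ^ 3 * ρm z s x) * ρm z s x ^ 2; Literature.MathematicalPhysics.KineticTheory.localGibbsLaw σ a₀ u₀ θ₀ N (Φ N) {z | η < |D z|} ≤ ENNReal.ofReal δ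

/-- item stmt-AtomisticToContinuum-13352 · crux · rank 4 · open · by planner
why it might fail: no H-theorem for a deterministic interacting gas: a LOCAL clamped inequality needs entropy flux = Z(s)m (no Euler-order heat current) and positive-time concentration of the mollified fields (ρs concave); only the GLOBAL Gibbs variational bound (Liouville) is free.
sources: BrezinaFeireisl2018, BrezinaFeireisl2018Revisited, Resibois1978, OllaVaradhanYau1993, Spohn1991
[crux] CLAMPED LOCAL SECOND LAW IN PROBABILITY (replaces the card's crux 3: weak–strong uniqueness
for the COMPLETE Euler system consumes local entropy admissibility, not cubic UI). ∃η₀ ∀η₁ ≤ η₀: for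
σ < σ₀(η₁, profiles), local Gibbs data, every τ, reals a < b and smooth φ ≥ 0 on ℝ×𝕋³ vanishing for
s ≥ τ′ < τ: P(∫₀^τ∫[ρ_r Z_(a,b)(s_c)∂_sφ + Z_(a,b)(s_c) m_r·∇φ]dx ds + ∫ρ_r(0)Z_(a,b)(s_c(0))φ(0)dx
> η) → 0 (N → ∞ then r → 0; s_c is the PHYSICAL entropy, so production makes the functional ≤ 0,
BF18 (2.11)), with (ρ_r, m_r, e_r) the tent-mollified empirical conserved fields, θ_r = ⅔(e_r/ρ_r −
|m_r|²/2ρ_r²), s_c = 3/2 log θ_r − log ρ_r − F_c(ρ_rσ³), F_c(η) = f_ex(min η η₁) + f_ex′(η₁)(η−η₁)₊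
the C¹ cut consistent with Y₁, Z_(a,b)(s) = max a (min s b): BF18's renormalised entropy inequality
for the limit. Pure particle statement — no Euler solution, no data tie, t = 0 term from the
empirical fields themselves. [difficulty: open-problem] -/
@[route_item "route-AtomisticToContinuum-LimitCollisionMeasure", crux]
def LocalSecondLaw : Prop :=
  ∃ η₀ : ℝ, 0 < η₀ ∧ ∀ η₁ : ℝ, 0 < η₁ → η₁ ≤ η₀ → ∀ (a₀ θ₀ : Literature.MathematicalPhysics.KineticTheory.T3 → ℝ) (u₀ : Literature.MathematicalPhysics.KineticTheory.T3 → Literature.MathematicalPhysics.KineticTheory.V3), Continuous a₀ → Continuous θ₀ → Continuous u₀ → (∀ x, 0 < a₀ x) → (∀ x, 0 < θ₀ x) → ∃ σ₀ : ℝ, 0 < σ₀ ∧ ∀ σ : ℝ, 0 < σ → σ < σ₀ → ∀ Φ : (N : ℕ) → Literature.Analysis.FluidPDE.HardSphereFlow (Literature.Analysis.FluidPDE.Torus.geometry (Fin 3)) (Literature.MathematicalPhysics.KineticTheory.hsDiameter σ N) (N + 1), ∀ τ : ℝ, 0 < τ → ∀ a b : ℝ, a < b → ∀ φ : ℝ →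 Literature.MathematicalPhysics.KineticTheory.T3 → ℝ, Literature.Analysis.FunctionSpaces.Torus.IsSmoothSpaceTimeOn Set.univ φ → (∀ s x, 0 ≤ φ s x) → (∃ τ' : ℝ, τ' < τ ∧ ∀ s, τ' ≤ s → ∀ x, φ s x = 0) → ∀ η δ : ℝ, 0 < η → 0 < δ → ∃ r₀ : ℝ, 0 < r₀ ∧ ∀ r : ℝ, 0 < r → r < r₀ → ∃ N₀ : ℕ, ∀ N : ℕ, N₀ ≤ N → let μ := fun (z : Literature.Analysis.FluidPDE.Config (N + 1) (Fin 3) Literature.MathematicalPhysics.KineticTheory.T3) (s : ℝ) => Literature.Analysis.FluidPDE.empiricalMeasure ((Φ N).flow s z); let bx : Literature.MathematicalPhysics.KineticTheory.T3 → Literature.MathematicalPhysics.KineticTheory.T3 → ℝ := fun x y => 3 / (Real.pi * r ^ 3) * max (1 - Literature.Analysis.FluidPDE.Torus.euclidDist x y / r) 0; let ρm := fun (z : Literature.Analysis.FluidPDE.Config (N + 1) (Fin 3) Literature.MathematicalPhysics.KineticTheory.T3) (s : ℝ) (x₀ : Literature.MathematicalPhysics.KineticTheory.T3) => ∫ q,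 bx q.1 x₀ ∂(μ z s); let mm := fun (z : Literature.Analysis.FluidPDE.Config (N + 1) (Fin 3) Literature.MathematicalPhysics.KineticTheory.T3) (s : ℝ) (x₀ : Literature.MathematicalPhysics.KineticTheory.T3) => ∫ q, bx q.1 x₀ • q.2 ∂(μ z s); let em := fun (z : Literature.Analysis.FluidPDE.Config (N + 1) (Fin 3) Literature.MathematicalPhysics.KineticTheory.T3) (s : ℝ) (x₀ : Literature.MathematicalPhysics.KineticTheory.T3) => ∫ q, bx q.1 x₀ * (‖q.2‖ ^ 2 / 2) ∂(μ z s); let θm := fun (z : Literature.Analysis.FluidPDE.Config (N + 1) (Fin 3) Literature.MathematicalPhysics.KineticTheory.T3) (s : ℝ) (x₀ : Literature.MathematicalPhysics.KineticTheory.T3) => 2 / 3 * (em z s x₀ / ρm z s x₀ - ‖mm z s x₀‖ ^ 2 / (2 * ρm z s x₀ ^ 2)); let Fc : ℝ → ℝ := fun c => Literature.MathematicalPhysics.KineticTheory.hsExcessFreeEnergy (min c η₁) + deriv Literature.MathematicalPhysics.KineticTheory.hsExcessFreeEnergy η₁ * max (c - η₁) 0; let Zs : ℝ → ℝ → ℝ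 := fun c d => max a (min (3 / 2 * Real.log d - Real.log c - Fc (c * σ ^ 3)) b); let I := fun (z : Literature.Analysis.FluidPDE.Config (N + 1) (Fin 3) Literature.MathematicalPhysics.KineticTheory.T3) => (∫ s in Set.Icc (0 : ℝ) τ, ∫ x : Literature.MathematicalPhysics.KineticTheory.T3, (ρm z s x * Zs (ρm z s x) (θm z s x) * Literature.Analysis.FunctionSpaces.Torus.timeDeriv φ s x + Zs (ρm z s x) (θm z s x) * inner ℝ (mm z s x) (Literature.Analysis.FunctionSpaces.Torus.gradient (φ s) x))) + ∫ x : Literature.MathematicalPhysics.KineticTheory.T3, ρm z 0 x * Zs (ρm z 0 x) (θm z 0 x) * φ 0 x; Literature.MathematicalPhysics.KineticTheory.localGibbsLaw σ a₀ u₀ θ₀ N (Φ N) {z | η < I z} ≤ ENNReal.ofReal δ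

/-- item stmt-AtomisticToContinuum-13353 · crux · rank 5 · open · by planner
why it might fail: BF18 Thm 3.3 must be re-run for a RANDOM limit pair with clamped entropies, the cut EOS and Lean junk (ρ_r = 0, log 0 = 0); the collisional stress must be shown defect-free from 4th-moment tightness; tightness/Skorokhod for (μ^N, κ^N) in this form is unprinted.
sources: BrezinaFeireisl2018, BrezinaFeireisl2018Revisited, FeireislNovotny2012, LuMouhot2015, SaintRaymond2009, Wiedemann2018
[crux] THE LIMIT-PAIR REDUCTION (theorem-track; stated as the implication from the route's particle
statements to the packing-guarded conjunct): ContactChaos → CollisionRate → LocalSecondLaw →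
CollisionTightness (inlined verbatim) → HsEosLowDensity (inlined verbatim) → ∃η_c > 0 ∀η₁ < η_c
∀profiles ∃σ₀ ∀σ < σ₀ ∀ classical hs-Euler solutions on [0,T) with ρσ³ ≤ η₁/2 ∀ flow families with
the t = 0 LLN: the empirical fields converge in probability to (ρ, ρu, E)(t) at every t < T.
Intended proof: (i) tightness of (μ^N, κ^N) as random measures on [0,τ]×𝕋³×ℝ³ resp. ×S²×ℝ³×ℝ³
(energy conservation + CollisionTightness), Skorokhod subsequences; (ii) EmpiricalEnskogIdentity ÷
ν_N ⇒ balance and exchange symmetry of κ̄ pathwise; undivided, with collision invariants ⇒ the five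
conservation laws with kinetic fluxes ⟨μ̄, v⊗v⟩ and collisional-transfer fluxes = explicit ω-moments
of κ̄ (ε_Nν_N = O(σ³)); (iii) ContactChaos + BalanceRigidity ⇒ μ̄_(t,x) = ρ̄M_(ū,θ̄) with the
conserved-field parameters and no defect; CollisionRate (+ HsEos, η_c ≤ η₀) ⇒ λ = σ³Y₁ρ̄², p =
ρ̄θ̄Z_c(ρ̄σ³), zero heat flux; (iv) LocalSecondLaw + exact energy ⇒ the limit is a.s. a dissipative
(Dirac-Young-measure) solution of th -/
@[route_item "route-AtomisticToContinuum-LimitCollisionMeasure", crux]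
def LimitPairStability : Prop :=
  ContactChaos → CollisionRate → LocalSecondLaw → (∀ (a₀ θ₀ : Literature.MathematicalPhysics.KineticTheory.T3 → ℝ) (u₀ : Literature.MathematicalPhysics.KineticTheory.T3 → Literature.MathematicalPhysics.KineticTheory.V3), Continuous a₀ → Continuous θ₀ → Continuous u₀ → (∀ x, 0 < a₀ x) → (∀ x, 0 < θ₀ x) → ∃ σ₀ : ℝ, 0 < σ₀ ∧ ∀ σ : ℝ, 0 < σ → σ < σ₀ → ∀ Φ : (N : ℕ) → Literature.Analysis.FluidPDE.HardSphereFlow (Literature.Analysis.FluidPDE.Torus.geometry (Fin 3)) (Literature.MathematicalPhysics.KineticTheory.hsDiameter σ N) (N + 1), ∀ τ : ℝ, 0 < τ → ∀ δ : ℝ, 0 < δ → ∃ Kb : ℝ, ∃ N₀ : ℕ, ∀ N : ℕ, N₀ ≤ N → Literature.MathematicalPhysics.KineticTheory.localGibbsLaw σ a₀ u₀ θ₀ N (Φ N) {z | Kb < Literature.MathematicalPhysics.KineticTheory.hsDiameter σ N / (N + 1 : ℝ) * ∫ m, (1 + ‖m.2.2.2.1‖ ^ 4 + ‖m.2.2.2.2‖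 ^ 4) * (1 + 1 / (Real.pi * ‖m.2.2.2.1 - m.2.2.2.2‖)) ∂((Φ N).empiricalCollisionMeasure (Set.Icc 0 τ) z)} ≤ ENNReal.ofReal δ) → (∃ η₀ : ℝ, 0 < η₀ ∧ ∃ F : ℝ → ℝ, AnalyticOnNhd ℝ F (Set.Ioo (-η₀) η₀) ∧ Set.EqOn Literature.MathematicalPhysics.KineticTheory.hsExcessFreeEnergy F (Set.Ico 0 η₀) ∧ F 0 = 0 ∧ deriv F 0 = 2 * Real.pi / 3 ∧ ∀ η ∈ Set.Ico 0 η₀, Filter.Tendsto (fun N : ℕ => -(N : ℝ)⁻¹ * Real.log (Literature.MathematicalPhysics.KineticTheory.hsFreeVolume η N)) Filter.atTop (nhds (F η))) → ∃ ηc : ℝ, 0 < ηc ∧ ∀ η₁ : ℝ, 0 < η₁ → η₁ < ηc → ∀ (a₀ θ₀ : Literature.MathematicalPhysics.KineticTheory.T3 → ℝ) (u₀ : Literature.MathematicalPhysics.KineticTheory.T3 → Literature.MathematicalPhysics.KineticTheory.V3), Continuous a₀ → Continuous θ₀ → Continuous u₀ → (∀ x, 0 < a₀ x) → (∀ x, 0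 < θ₀ x) → ∃ σ₀ : ℝ, 0 < σ₀ ∧ ∀ σ : ℝ, 0 < σ → σ < σ₀ → ∀ (T : ℝ) (ρ θ : ℝ → Literature.MathematicalPhysics.KineticTheory.T3 → ℝ) (u : ℝ → Literature.MathematicalPhysics.KineticTheory.T3 → Literature.MathematicalPhysics.KineticTheory.V3), Literature.MathematicalPhysics.KineticTheory.IsHardSphereEulerSolution σ T ρ u θ → (∀ t ∈ Set.Ico 0 T, ∀ x, ρ t x * σ ^ 3 ≤ η₁ / 2) → ∀ Φ : (N : ℕ) → Literature.Analysis.FluidPDE.HardSphereFlow (Literature.Analysis.FluidPDE.Torus.geometry (Fin 3)) (Literature.MathematicalPhysics.KineticTheory.hsDiameter σ N) (N + 1), Literature.MathematicalPhysics.KineticTheory.TendstoHydroFieldsAt (fun N => Literature.MathematicalPhysics.KineticTheory.localGibbsLaw σ a₀ u₀ θ₀ N (Φ N)) Φ ρ u θ 0 → ∀ t ∈ Set.Ico 0 T, Literature.MathematicalPhysics.KineticTheory.TendstoHydroFieldsAt (fun N => Literature.MathematicalPhysics.KineticTheory.localGibbsLaw σ a₀ u₀ θ₀ N (Φ N)) Φ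 ρ u θ t

/-- item stmt-AtomisticToContinuum-13354 · crux · rank 9 · open · by planner
why it might fail: no a-priori collision bound out of equilibrium: transient near-close-packed clusters (contact value Y(η) → ∞) or energy concentration before τ could push the |v|⁴- and 1/|v−v*|-weighted super-extensive count past O(N^(4/3)) with positive probability; only the invariant-law mean is explicit.
sources: Chernov1997, BuragoFerlegerKononenko1998, PulvirentiSimonella2015, GST2013, Spohn1991
[support] MOMENT TIGHTNESS OF THE NORMALISED COLLISION MEASURE (card S1, strengthened to carry every
uniform-integrability need of the reduction): for σ < σ₀(profiles), local Gibbs data, every τ, δ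
there are K, N₀ with P((ε/(N+1))∫(1 + |v|⁴ + |v*|⁴)(1 + 1/(π|v−v*|))dκ^N > K) ≤ δ for N ≥ N₀.
Expected proof: E under the invariant canonical law by stationarity (Enskog/Santaló value, finite),
an equilibrium large-deviation bound for the super-extensive (N^(4/3)) count, and Cauchy–Schwarz /
entropy transfer to the local Gibbs law (engine of card spacetime-superextensive-ld); not routine.
[difficulty: M] -/
@[route_item "route-AtomisticToContinuum-LimitCollisionMeasure", crux]
def CollisionTightness : Prop :=
  ∀ (a₀ θ₀ : Literature.MathematicalPhysics.KineticTheory.T3 → ℝ) (u₀ : Literature.MathematicalPhysics.KineticTheory.T3 → Literature.MathematicalPhysics.KineticTheory.V3), Continuous a₀ → Continuous θ₀ → Continuous u₀ → (∀ x, 0 < a₀ x) → (∀ x, 0 < θ₀ x) → ∃ σ₀ : ℝ, 0 < σ₀ ∧ ∀ σ : ℝ, 0 < σ → σ < σ₀ → ∀ Φ : (N : ℕ) → Literature.Analysis.FluidPDE.HardSphereFlow (Literature.Analysis.FluidPDE.Torus.geometry (Fin 3)) (Literature.MathematicalPhysics.KineticTheory.hsDiameter σ N) (N + 1), ∀ τ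 : ℝ, 0 < τ → ∀ δ : ℝ, 0 < δ → ∃ Kb : ℝ, ∃ N₀ : ℕ, ∀ N : ℕ, N₀ ≤ N → Literature.MathematicalPhysics.KineticTheory.localGibbsLaw σ a₀ u₀ θ₀ N (Φ N) {z | Kb < Literature.MathematicalPhysics.KineticTheory.hsDiameter σ N / (N + 1 : ℝ) * ∫ m, (1 + ‖m.2.2.2.1‖ ^ 4 + ‖m.2.2.2.2‖ ^ 4) * (1 + 1 / (Real.pi * ‖m.2.2.2.1 - m.2.2.2.2‖)) ∂((Φ N).empiricalCollisionMeasure (Set.Icc 0 τ) z)} ≤ ENNReal.ofReal δ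

/-- item stmt-AtomisticToContinuum-0768 · support · rank 9 · closed · proved by Summit.AtomisticToContinuum.HydrodynamicLimit.Theorems.hsEosLowDensity_proof (prover) · by planner
sources: Ruelle1969, LebowitzPenrose1964
[support] Hard-sphere equation of state at low density: ∃ η₀ > 0 and F real-analytic on (−η₀, η₀)
with hsExcessFreeEnergy = F on [0, η₀), F(0) = 0, F'(0) = 2π/3 (second virial coefficient of
unit-diameter spheres), and the canonical thermodynamic limit −N⁻¹ log hsFreeVolume η N → F(η)
exists (not just limsup) for η ∈ [0, η₀). Ruelle1969 §3.4 (existence), LebowitzPenrose1964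
(convergence of the virial expansion ⇒ analyticity). Makes hsCompressibility/hsPressure smooth and
Z(η) = 1 + (2π/3)η + O(η²); needed by every route (hyperbolicity of the Euler system, virial
theorem). -/
@[route_item "route-AtomisticToContinuum-LimitCollisionMeasure"]
def HsEosLowDensity : Prop :=
  ∃ η₀ : ℝ, 0 < η₀ ∧ ∃ F : ℝ → ℝ, AnalyticOnNhd ℝ F (Set.Ioo (-η₀) η₀) ∧ Set.EqOn Literature.MathematicalPhysics.KineticTheory.hsExcessFreeEnergy F (Set.Ico 0 η₀) ∧ F 0 = 0 ∧ deriv F 0 = 2 * Real.pi / 3 ∧ ∀ η ∈ Set.Ico 0 η₀, Filter.Tendsto (fun N : ℕ => -(N : ℝ)⁻¹ * Real.log (Literature.MathematicalPhysics.KineticTheory.hsFreeVolume η N)) Filter.atTop (nhds (F η))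

/-- `HsEosLowDensity` holds: proved by `Summit.AtomisticToContinuum.HydrodynamicLimit.Theorems.hsEosLowDensity_proof`. -/
theorem HsEosLowDensity_holds : HsEosLowDensity := _root_.Summit.AtomisticToContinuum.HydrodynamicLimit.Theorems.hsEosLowDensity_proof

/-- item stmt-AtomisticToContinuum-13355 · support · rank 9 · open · by planner
sources: LuMouhot2015, CercignaniIllnerPulvirenti1994, Villani2002
[support] BOLTZMANN'S UNIQUENESS OF COLLISION EQUILIBRIA, MEASURE VERSION (card S3): a finite Borel
measure m on ℝ³ with finite second moment whose product kernel is collisionally balanced,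
∫∫∫((v−w)·ω)₊[φ(v′)+φ(w′)−φ(v)−φ(w)]dω m(dv)m(dw) = 0 for all bounded continuous φ, is a (possibly
zero) point mass or ρ·Maxwellian(θ,u)·Lebesgue with ρ, θ > 0. [difficulty: M] -/
@[route_item "route-AtomisticToContinuum-LimitCollisionMeasure"]
def BalanceRigidity : Prop :=
  ∀ m : MeasureTheory.Measure Literature.MathematicalPhysics.KineticTheory.V3, MeasureTheory.IsFiniteMeasure m → MeasureTheory.Integrable (fun v => ‖v‖ ^ 2) m → (∀ φ : Literature.MathematicalPhysics.KineticTheory.V3 → ℝ, Continuous φ → (∃ C : ℝ, ∀ v, |φ v| ≤ C) → ∫ v, ∫ w, ∫ ω : Metric.sphere (0 : Literature.MathematicalPhysics.KineticTheory.V3) 1, Literature.MathematicalPhysics.KineticTheory.hardSphereKernel (v, w) ω * (φ (Literature.MathematicalPhysics.KineticTheory.collide ω (v, w)).1 + φ (Literature.MathematicalPhysics.KineticTheory.collide ω (v, w)).2 - φ v - φ w) ∂Literature.MathematicalPhysics.KineticTheory.sphereMeasure ∂m ∂m = 0) → (∃ c : ENNReal, ∃ u : Literature.MathematicalPhysics.KineticTheory.V3,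 m = c • MeasureTheory.Measure.dirac u) ∨ (∃ ρ θ : ℝ, ∃ u : Literature.MathematicalPhysics.KineticTheory.V3, 0 < ρ ∧ 0 < θ ∧ m = MeasureTheory.volume.withDensity (fun v => ENNReal.ofReal (Literature.Analysis.FluidPDE.localMaxwellian ρ θ u v)))

/-- item stmt-AtomisticToContinuum-13356 · support · rank 9 · open · by planner
sources: Bogolyubov1975, PulvirentiSimonella2015, GST2013
[support] THE EXACT IDENTITY along one trajectory (card S2; Bogolyubov's microscopic Enskog
equation, torus version, now over the library's `empiricalCollisionMeasure`): for every hard-sphere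
flow Φ on 𝕋³ (0 < ε < 1/2, any N), every good z, τ > 0, a ∈ C¹(ℝ), smooth b on 𝕋³, continuous c on
ℝ³: a(τ)⟨μ_τ, b c⟩ − a(0)⟨μ_0, b c⟩ − ∫₀^τ[a′⟨μ_s, b c⟩ + a⟨μ_s, (v·∇b)c⟩]ds = N⁻¹∫a(t)b(x)[c(v⁺) −
c(v⁻)]dκ(t,x,ω,v⁻,v*⁻) over collisions in (0,τ], v⁺ = (reflectVel ω (v⁻,v*⁻)).1. [difficulty:
provable-now] -/
@[route_item "route-AtomisticToContinuum-LimitCollisionMeasure"]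
def EmpiricalEnskogIdentity : Prop :=
  ∀ (ε : ℝ) (N : ℕ), 0 < ε → ε < 1 / 2 → ∀ Φ : Literature.Analysis.FluidPDE.HardSphereFlow (Literature.Analysis.FluidPDE.Torus.geometry (Fin 3)) ε N, ∀ z ∈ Φ.good, ∀ τ : ℝ, 0 < τ → ∀ a : ℝ → ℝ, ContDiff ℝ 1 a → ∀ b : Literature.MathematicalPhysics.KineticTheory.T3 → ℝ, Literature.Analysis.FunctionSpaces.Torus.IsSmooth b → ∀ c : Literature.MathematicalPhysics.KineticTheory.V3 → ℝ, Continuous c → let μ := fun s : ℝ => Literature.Analysis.FluidPDE.empiricalMeasure (Φ.flow s z); a τ * ∫ q, b q.1 * c q.2 ∂(μ τ) - a 0 * ∫ q, b q.1 * c q.2 ∂(μ 0) - ∫ s in Set.Icc (0 : ℝ) τ, (deriv a s * ∫ q, b q.1 * c q.2 ∂(μ s) + a s * ∫ q, (∑ k : Fin 3, q.2 k * Literature.Analysis.FunctionSpaces.Torus.partialDeriv k b q.1) * c q.2 ∂(μ s)) = (N : ℝ)⁻¹ * ∫ m, a m.1 * b m.2.1 * (c (Literature.Analysis.FluidPDE.reflectVel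 m.2.2.1 (m.2.2.2.1, m.2.2.2.2)).1 - c m.2.2.2.1) ∂(Φ.empiricalCollisionMeasure (Set.Ioc 0 τ) z)

-- earlier Assembly (stmt-AtomisticToContinuum-13357, replaced 2026-08-16T23:25:31Z -> stmt-AtomisticToContinuum-17652): retired by None — ContactChaos → CollisionRate → LocalSecondLaw → LimitPairStability → CollisionTightness → HsEosLowDensity → DiluteSelfConsistency → _root_.HydrodynamicLimit
-- earlier Assembly (stmt-AtomisticToContinuum-17652, replaced 2026-08-16T23:29:43Z -> stmt-AtomisticToContinuum-17725): retired by None — ContactChaos → CollisionRate → LocalSecondLaw → LimitPairStability → CollisionTightness → HsEosLowDensity → _root_.HydrodynamicLimit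
/-- item stmt-AtomisticToContinuum-17725 · assembly · rank 1 · open · by planner
sources: BrezinaFeireisl2018, Spohn1991, OllaVaradhanYau1993
[assembly] ContactChaos → CollisionRate → LocalSecondLaw → LimitPairStability → CollisionTightness →
HydrodynamicLimit (identical to the crux-only deciding theorem `closes`; the proved support
HsEosLowDensity is discharged inside the proof by `Theorems.hsEosLowDensity_proof`, and the packing
guard is part of the re-typed Statement). -/
@[route_item "route-AtomisticToContinuum-LimitCollisionMeasure"]
def Assembly : Prop :=
  ContactChaos → CollisionRate → LocalSecondLaw → LimitPairStability → CollisionTightness → _root_.HydrodynamicLimit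

/-! D-0027 §2.1 — DECIDING THEOREM (planner-authored via `route open/edit --closes-file`; by planner-rbadge-AtomisticToContinuum-LimitColli-e3a60225-0 2026-08-16T23:41:45Z):
its hypotheses are this route's items and its conclusion the sub-problem Statement (glue_lint), and it elaborates with this file. -/

/-- D-0027 §2.1 deciding theorem (route LimitCollisionMeasure, card limit-collision-measure-chaos),
CRUX-ONLY, for the packing-guarded conjunct `_root_.HydrodynamicLimit` (statement re-type hydro2,
p126922, D-0032): pure quantifier bookkeeping — LimitPairStability fed with the cruxes ContactChaos,
CollisionRate, LocalSecondLaw, CollisionTightness and with the PROVED support HsEosLowDensity (invoked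
as the tree theorem `Theorems.hsEosLowDensity_proof`, stmt-AtomisticToContinuum-0768, whose type is the
verbatim-identical shared decl) gives the band threshold η_c; take the Statement's packing threshold
η₀ := η_c/2/2 and the band η₁ := η_c/2, so the Statement's own guard `ρ σ³ < η₀` implies the band
hypothesis `ρ σ³ ≤ η₁/2` of LimitPairStability; σ₀ is LimitPairStability's, profile by profile.
Hypotheses = the route's five cruxes; no support item is assumed. Re-certified 2026-08-16 (unit
rbadge-…-e3a60225) against the current tree Statement `∃ η₀ > 0, ∀ profiles, … ∃ σ₀ > 0, ∀ σ T ρ θ u,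
IsHardSphereEulerSolution → guard → ∀ Φ, LLN(0) → ∀ t ∈ Ico 0 T, LLN(t)`; the fullbuild failure
`476:8 introN` was raised on the pre-retype text of this theorem (rev ≤ 1), not on this one. -/
@[closes "route-AtomisticToContinuum-LimitCollisionMeasure"] theorem closes (h₁ : ContactChaos) (h₂ : CollisionRate) (h₃ : LocalSecondLaw) (h₄ : LimitPairStability)
    (h₅ : CollisionTightness) : _root_.HydrodynamicLimit := by
  obtain ⟨ηc, hηc, H⟩ := h₄ h₁ h₂ h₃ h₅
    _root_.Summit.AtomisticToContinuum.HydrodynamicLimit.Theorems.hsEosLowDensity_proof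
  refine ⟨ηc / 2 / 2, half_pos (half_pos hηc), fun a₀ θ₀ u₀ ha hθ hu ha0 hθ0 => ?_⟩
  obtain ⟨σ₁, hσ₁, G⟩ := H (ηc / 2) (half_pos hηc) (half_lt_self hηc) a₀ θ₀ u₀ ha hθ hu ha0 hθ0
  exact ⟨σ₁, hσ₁, fun σ hσ hσlt T ρ θ u hEul hguard Φ hL0 t ht =>
    G σ hσ hσlt T ρ θ u hEul (fun s hs x => le_of_lt (hguard s hs x)) Φ hL0 t ht⟩

end Summit.AtomisticToContinuum.HydrodynamicLimit.Theses.LimitCollisionMeasure
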